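import Summits.ResolutionOfSingularities.ResolutionOfSingularities.Theorems.WeightedInvariantHypersurfaceAdmissibleSequences
import Summits.ResolutionOfSingularities.ResolutionOfSingularities.Theorems.WeightedInvariantWeightedThesisHypersurfaceChoiceDimZero
import HarnessLib

/-!
# The ∃-form of the door BY START DIMENSION — the e-ladder of finite admissible centre sequences

Route `ResolutionOfSingularities/WeightedInvariant`, crux `Theses.WeightedInvariant.HypersurfaceCentreConstruction`
(stmt-ResolutionOfSingularities-19897: `∀ p prime, Nonempty (HypersurfaceTerminatingCentreDatum p)`), door line
`local-engine`; CRUX-PLAN r1 §v6.4 (4) of `res-L1-w43-plan-1` (e-ladder rung statements over the new datum,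
`res-L1-w43-stub-10`), `res-L1-w43-tri-2` TRIAGE v3 TN-∃, and the forward ladder
`Cruxes/GlobalizeLocalDrop/LADDER-GlobalizeLocalDrop.md` (transversal dimension as the ladder variable).

`Theorems/…HypersurfaceAdmissibleSequences.lean` types the ∃-form of the door — every SINGULAR hypersurface pair
`P` over a perfect field of characteristic `p` is `HypersurfacePair.Resolvable`: some finite sequence of centres,
each ADMISSIBLE (`IsAdmissibleCentre`: `(iii-a)` regular weighted centre, `(iii-b′)` support under the non-regular
locus, `(hom)` homogeneous on every graded affine chart) on the CURRENT pair, whose iterated `B₊`-successors end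
in a regular strict transform — and proves ∃-form ⇒ door datum
(`nonempty_hypersurfaceTerminatingCentreDatum_of_finiteSequences`).  The ∃-form is cut along the dimension of
the hypersurface one STARTS from (the transversal dimension of the forward ladder; along a sequence the
dimension grows by one per step, so only the start is constrained):

* `AdmissiblyResolvableDim p e` — **∃-RUNG `e`**: over every perfect field of characteristic `p`, every
  hypersurface pair whose (integral) hypersurface has dimension `e` and is not regular is admissibly resolvable.
  History IS available to a witness (it is one finite sequence from the start), canonicity is not owed, and
  `(hom)` is owed on every pair of the sequence for every grading of every affine chart of that pair.
* `HypersurfacePair.exists_nat_topologicalKrullDim` — every hypersurface pair starts on some rung (its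
  hypersurface is a non-empty scheme of finite type over `k`).
* `nonempty_hypersurfaceTerminatingCentreDatum_of_forall_admissiblyResolvableDim` /
  `hypersurfaceCentreConstruction_of_forall_admissiblyResolvableDim` — **all ∃-rungs at a prime give the door
  datum at that prime; all ∃-rungs at all primes give the door item `HypersurfaceCentreConstruction` BY NAME.**
* `admissiblyResolvableDim_zero` — ∃-rung `e = 0` holds (vacuous: a `0`-dimensional integral hypersurface is
  regular, `isRegular_of_topologicalKrullDim_eq_zero`).

∃-rung `e = 1` is the sector of Abramovich–Quek–Schober 2025 (arXiv:2507.01232, Thm. 1.1: on a hypersurface in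
a regular scheme with a torus action with finite stabilisers, the unique invariant centre of maximal invariant
along a singular closed orbit lowers the invariant at every point above it; «iterating, one obtains in finitely
many steps» a regular strict transform); ∃-rung `e = 2` is the sector of embedded resolution of surfaces
(Cossart–Jannsen–Saito) made torus-homogeneous.  Their closed-modulo-facts plans are in the stub worker's note
(cell res-hironaka, `D/res-D-pv-025/DOOR-ELADDER-PLAN.md`).  Nothing here is a claim about Hironaka's problem;
no ∃-rung `e ≥ 1` is asserted.
-/

noncomputable section

open CategoryTheory AlgebraicGeometry TopologicalSpace
open Literature.AlgebraicGeometry.Resolution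

set_option linter.dupNamespace false -- mandated namespace of this single-conjunct summit

namespace Summit.ResolutionOfSingularities.ResolutionOfSingularities.Theorems

/-! ## Every hypersurface pair starts on some rung -/

namespace HypersurfacePair

variable {k : Type} [Field k]

/-- **The hypersurface of a hypersurface pair has a natural-number dimension**: `V(X)` is a non-empty
(integral) closed subscheme of the quasi-compact `k`-scheme `Y` locally of finite type (smooth), hence a
non-empty `k`-scheme of finite type, so `dim V(X) = e` for some `e : ℕ` (tree:
`exists_topologicalKrullDim_le_of_locallyOfFiniteType`, `exists_topologicalKrullDim_eq_nat`; compare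
`hyp_exists_nat_topologicalKrullDim_ker_subscheme` for the closed-immersion form). [folklore] -/
theorem exists_nat_topologicalKrullDim (P : HypersurfacePair k) :
    ∃ e : ℕ, topologicalKrullDim P.X.subscheme = (e : WithBot ℕ∞) := by
  haveI := P.isIntegral
  haveI : QuasiCompact (P.X.subschemeι ≫ P.f) := inferInstance
  haveI : CompactSpace P.X.subscheme :=
    QuasiCompact.compactSpace_of_compactSpace (P.X.subschemeι ≫ P.f)
  obtain ⟨d, hd⟩ := exists_topologicalKrullDim_le_of_locallyOfFiniteType (P.X.subschemeι ≫ P.f)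
  exact exists_topologicalKrullDim_eq_nat hd

end HypersurfacePair

/-! ## The ∃-rungs -/

/-- **∃-RUNG `e` of the door `HypersurfaceCentreConstruction` (stmt-19897): admissible resolvability from
START DIMENSION `e` in characteristic `p`.**  Over every perfect field `k` of characteristic `p`, every
hypersurface pair `P = (Y → Spec k, X)` (`Y` smooth separated quasi-compact, `X` locally principal with integral
`V(X)`) whose hypersurface has dimension `e` and is NOT regular is `HypersurfacePair.Resolvable`: there is a
finite sequence of centres, each admissible on the current pair (`IsAdmissibleCentre`: regular weighted centre,
support under the non-regular locus of the current hypersurface, every piece homogeneous for every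
`ℤʲ`-grading of every affine chart of the current ambient with constants in degree `0` and the hypersurface
ideal homogeneous), whose iterated global cobordant blow-ups `B₊` carry the strict transform to a regular one
(`HypersurfacePair.AdmissiblyResolvable`).  All ∃-rungs at `p` give the door datum at `p`
(`nonempty_hypersurfaceTerminatingCentreDatum_of_forall_admissiblyResolvableDim`).  `e = 0` holds
(`admissiblyResolvableDim_zero`); `e = 1` is the sector of Abramovich–Quek–Schober, arXiv:2507.01232 Thm. 1.1;
`e = 2` that of Cossart–Jannsen–Saito made torus-homogeneous.  CANDIDATE statement for `e ≥ 1`, not a claim.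
[cite: AbramovichQuekSchober2025, Thm. 1.1] -/
@[conjecture]
def AdmissiblyResolvableDim (p e : ℕ) : Prop :=
  ∀ ⦃k : Type⦄ [Field k] [CharP k p] [PerfectField k] (P : HypersurfacePair k),
    topologicalKrullDim P.X.subscheme = (e : WithBot ℕ∞) → ¬ Scheme.IsRegular P.X.subscheme → P.Resolvable

/-- Unfolding an ∃-rung at a pair. [folklore] -/
theorem AdmissiblyResolvableDim.resolvable {p e : ℕ} (h : AdmissiblyResolvableDim p e) {k : Type} [Field k]
    [CharP k p] [PerfectField k] (P : HypersurfacePair k)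
    (hdim : topologicalKrullDim P.X.subscheme = (e : WithBot ℕ∞)) (hsing : ¬ Scheme.IsRegular P.X.subscheme) :
    P.Resolvable :=
  h P hdim hsing

/-! ## All ∃-rungs give the ∃-form, hence the door -/

/-- **All ∃-rungs at `p` ⇒ the ∃-form at `p`**: a singular hypersurface pair starts on the rung of the
dimension of its hypersurface (`HypersurfacePair.exists_nat_topologicalKrullDim`). [folklore] -/
theorem forall_resolvable_of_forall_admissiblyResolvableDim {p : ℕ} (h : ∀ e : ℕ, AdmissiblyResolvableDim p e)
    ⦃k : Type⦄ [Field k] [CharP k p] [PerfectField k] (P : HypersurfacePair k)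
    (hsing : ¬ Scheme.IsRegular P.X.subscheme) : P.Resolvable := by
  obtain ⟨e, he⟩ := P.exists_nat_topologicalKrullDim
  exact h e P he hsing

/-- **All ∃-rungs at `p` ⇒ the door datum at `p`** (through the ∃-form,
`nonempty_hypersurfaceTerminatingCentreDatum_of_finiteSequences`: `Γ := Bool`, `centre :=` first centre of a
length-minimiser, `Λ := ℕ`, `rank :=` minimal length). [folklore] -/
theorem nonempty_hypersurfaceTerminatingCentreDatum_of_forall_admissiblyResolvableDim (p : ℕ)
    (h : ∀ e : ℕ, AdmissiblyResolvableDim p e) : Nonempty (HypersurfaceTerminatingCentreDatum p) :=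
  nonempty_hypersurfaceTerminatingCentreDatum_of_finiteSequences p
    fun _ _ _ _ P hsing => forall_resolvable_of_forall_admissiblyResolvableDim h P hsing

/-- **All ∃-rungs at all primes ⇒ the door item `HypersurfaceCentreConstruction` (stmt-19897) BY NAME.**  The top
of the ∃-ladder is the door (modulo nothing); each rung is a START-DIMENSION slice of it. [folklore] -/
theorem hypersurfaceCentreConstruction_of_forall_admissiblyResolvableDim
    (h : ∀ p : ℕ, p.Prime → ∀ e : ℕ, AdmissiblyResolvableDim p e) :
    Summit.ResolutionOfSingularities.ResolutionOfSingularities.Theses.WeightedInvariant.HypersurfaceCentreConstruction :=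
  fun p hp => nonempty_hypersurfaceTerminatingCentreDatum_of_forall_admissiblyResolvableDim p (h p hp)

/-! ## ∃-rung `e = 0` holds -/

/-- **∃-rung `e = 0`: a `0`-dimensional integral hypersurface is regular**, so there is nothing to resolve
(`isRegular_of_topologicalKrullDim_eq_zero`). The sanity rung of the ∃-ladder. [folklore] -/
theorem admissiblyResolvableDim_zero (p : ℕ) : AdmissiblyResolvableDim p 0 := by
  intro k _ _ _ P hdim hsing
  haveI := P.isIntegral
  exact absurd (isRegular_of_topologicalKrullDim_eq_zero (by exact_mod_cast hdim)) hsing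

/-- A regular start pair is admissibly resolvable in `0` steps (so every ∃-rung may equivalently drop the
non-regularity guard). [folklore] -/
theorem HypersurfacePair.resolvable_of_isRegular {k : Type} [Field k] (P : HypersurfacePair k)
    (hreg : Scheme.IsRegular P.X.subscheme) : P.Resolvable :=
  ⟨0, (HypersurfacePair.admissiblyResolvable_zero_iff P).mpr hreg⟩

/-- **∃-rung `e` without the guard**: `AdmissiblyResolvableDim p e` iff EVERY hypersurface pair of start
dimension `e` (regular or not) is admissibly resolvable. [folklore] -/
theorem admissiblyResolvableDim_iff_forall_resolvable (p e : ℕ) :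
    AdmissiblyResolvableDim p e ↔
      ∀ ⦃k : Type⦄ [Field k] [CharP k p] [PerfectField k] (P : HypersurfacePair k),
        topologicalKrullDim P.X.subscheme = (e : WithBot ℕ∞) → P.Resolvable := by
  constructor
  · intro h k _ _ _ P hdim
    by_cases hreg : Scheme.IsRegular P.X.subscheme
    · exact P.resolvable_of_isRegular hreg
    · exact h P hdim hreg
  · intro h k _ _ _ P hdim _
    exact h P hdim

end Summit.ResolutionOfSingularities.ResolutionOfSingularities.Theorems

end
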